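import Literature.Geometry.Riemannian.SurgicalRicciFlowNeckStep
import Literature.Geometry.Riemannian.ProjectiveCapObstruction
import HarnessLib

/-!
# Restricting a surgery step to a connected component

Part of the deduction of Hamilton's Cor. 1.2(a)
(`Literature.Geometry.Riemannian.hamilton_chen_tang_zhu`) from Chen–Zhu's Thm. 1.1
(`Literature.Geometry.Riemannian.chenZhu_ricciFlowWithSurgery`). Chen–Zhu's manifolds `M_k` are
"compact (possible disconnected)" (Thm. 1.1 (i)), while Hamilton's surgery programme in its
topological shadow (`Literature.Geometry.Riemannian.IsNeckSurgeryResolvable`,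
`HamiltonSurgeryProgramme.lean`) and the sides of necks (`NeckCapping.lean`) are about connected,
indeed simply connected, manifolds. This file restricts the data of a surgery step
`(N, U, U', Φ, Ψ)` on `M` (relative to `(M', N')`, in the unbundled format of
`SurgicalRicciFlowBallAbsorption.lean`) to a closed connected component `X` of `M`, viewed as an
open submanifold (`TopologicalSpace.Opens`):

* `exists_restrict_component`: either `X` is one of the discarded pieces (then it is an iterated
  connected sum of Hamilton's pieces), or some collared projective cap `ℝℙ⁴ ∖ 𝔹̄⁴` lies in `X`
  (then `X` is not simply connected, by `ProjectiveCapObstruction.lean`), or `X` carries data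
  `(N_X, U_X, U_X', Φ_X, Ψ_X)` of the same kind whose pieces are the neck and ball pieces of
  `M ∖ N` inside `X`.

The only non-formal point is that the collar `ι : ℝℙ⁴ ∖ 𝔹̄⁴ ↪ M` of a projective cap piece
`C ⊆ X` has its whole range inside `X`: every point of the punctured projective space is joined,
inside it, to a point of height `0` by the meridian arc `t ↦ [y - t y₀ e₀]`
(`exists_isPreconnected_joining_lowZone`), and the low zone is mapped into `C ⊆ X`.

## References

* B.-L. Chen, X.-P. Zhu, *Ricci flow with surgery on four-manifolds with positive isotropic
  curvature*, J. Differential Geom. 74 (2006), Thm. 1.1 (i)–(iv) (p. 3). [ChenZhu2006]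
* R. S. Hamilton, *Four-manifolds with positive isotropic curvature*, Comm. Anal. Geom. 5 (1997),
  §1.1 pp. 3–4. [Hamilton1997]
-/

noncomputable section

open Set Function Metric TopologicalSpace Filter
open scoped Manifold ContDiff Topology RealInnerProductSpace

namespace Literature.Geometry.Riemannian

open Literature.Topology.FourManifolds Literature.Topology.FourManifolds.RealProjectiveSpace
  ProjectiveCap

/-! ### The punctured projective space is joined to its low zone -/

section Zone

variable {n : ℕ}

/-- The meridian vector `y - t y₀ e₀`. [folklore] -/
theorem norm_sq_sub_smul_single (y : EuclideanSpace ℝ (Fin (n + 1))) (hy : ‖y‖ = 1) (t : ℝ) :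
    ‖y - (t * y 0) • EuclideanSpace.single (0 : Fin (n + 1)) (1 : ℝ)‖ ^ 2 =
      1 - (2 * t - t ^ 2) * (y 0) ^ 2 := by
  have hs : ‖EuclideanSpace.single (0 : Fin (n + 1)) (1 : ℝ)‖ = 1 := by simp
  rw [@norm_sub_sq_real, hy, inner_smul_right, EuclideanSpace.inner_single_right, norm_smul, hs,
    Real.norm_eq_abs]
  simp only [one_mul, conj_trivial, mul_one]
  rw [sq_abs]
  ring

/-- **Every point of the punctured projective space `{height < 1/2}` is joined, inside it, to a
point of height `0`** by a preconnected set (the projection of the meridian arc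
`t ↦ (y - t y₀ e₀)/‖y - t y₀ e₀‖`, `t ∈ [0, 1]`, along which the height `|y₀|` does not increase
past `1/2`). [folklore] -/
theorem exists_isPreconnected_joining_lowZone (p : puncturedRealProjectiveSpace n) :
    ∃ s : Set (puncturedRealProjectiveSpace n), IsPreconnected s ∧ p ∈ s ∧
      ∃ q ∈ s, height (q : RealProjectiveSpace n) = 0 := by
  obtain ⟨y, hy⟩ := mk_surjective n (p : RealProjectiveSpace n)
  have hp : height (p : RealProjectiveSpace n) < 1 / 2 :=
    (mem_puncturedRealProjectiveSpace_iff_height _).1 p.2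
  rw [← hy, height_mk] at hp
  have hy1 : ‖(y : EuclideanSpace ℝ (Fin (n + 1)))‖ = 1 := norm_eq_of_mem_sphere y
  have hy0 : ((y : EuclideanSpace ℝ (Fin (n + 1))) 0) ^ 2 < 1 / 4 := by
    have := abs_lt.1 hp
    nlinarith [this.1, this.2]
  -- the meridian vector and its norm
  set e0 : EuclideanSpace ℝ (Fin (n + 1)) := EuclideanSpace.single 0 1 with he0
  set v : ℝ → EuclideanSpace ℝ (Fin (n + 1)) :=
    fun t => (y : EuclideanSpace ℝ (Fin (n + 1))) - (t * (y : EuclideanSpace ℝ (Fin (n + 1))) 0) • e0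
    with hv
  have he00 : e0 0 = 1 := by simp [he0]
  have hv0 : ∀ t, v t 0 = (1 - t) * (y : EuclideanSpace ℝ (Fin (n + 1))) 0 := fun t => by
    simp only [hv, PiLp.sub_apply, PiLp.smul_apply, smul_eq_mul, he00, mul_one]
    ring
  have hvnorm : ∀ t, ‖v t‖ ^ 2 = 1 - (2 * t - t ^ 2) * ((y : EuclideanSpace ℝ (Fin (n + 1))) 0) ^ 2 :=
    fun t => norm_sq_sub_smul_single _ hy1 t
  have hvpos : ∀ t ∈ Icc (0 : ℝ) 1, (1 : ℝ) / 2 ≤ ‖v t‖ := by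
    intro t ht
    have h1 : (1 : ℝ) / 4 ≤ ‖v t‖ ^ 2 := by
      rw [hvnorm]
      have : 0 ≤ 2 * t - t ^ 2 := by nlinarith [ht.1, ht.2]
      have : 2 * t - t ^ 2 ≤ 1 := by nlinarith [ht.1, ht.2]
      nlinarith
    nlinarith [norm_nonneg (v t)]
  have hvne : ∀ t ∈ Icc (0 : ℝ) 1, v t ≠ 0 := fun t ht h => by
    have := hvpos t ht; rw [h, norm_zero] at this; linarith
  -- height along the arc
  have hheight : ∀ t ∈ Icc (0 : ℝ) 1, |‖v t‖⁻¹ * v t 0| < 1 / 2 := by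
    intro t ht
    have hn := hvpos t ht
    have hnpos : 0 < ‖v t‖ := by linarith
    rw [abs_mul, abs_inv, abs_norm, ← div_eq_inv_mul, div_lt_iff₀ hnpos, hv0]
    -- `|(1 - t) y₀| < ‖v t‖ / 2`: compare squares
    have key : ((1 - t) * (y : EuclideanSpace ℝ (Fin (n + 1))) 0) ^ 2 < (1 / 2 * ‖v t‖) ^ 2 := by
      rw [mul_pow, mul_pow, hvnorm]
      nlinarith [ht.1, ht.2, hy0, sq_nonneg (t - 1)]
    have h2 : 0 ≤ 1 / 2 * ‖v t‖ := by positivity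
    exact abs_lt.2 (abs_lt_of_sq_lt_sq' key h2)
  -- the arc in the punctured projective space
  set z : ℝ → EuclideanSpace ℝ (Fin (n + 1)) := fun t => ‖v t‖⁻¹ • v t with hz
  have hzs : ∀ t ∈ Icc (0 : ℝ) 1, z t ∈ Metric.sphere (0 : EuclideanSpace ℝ (Fin (n + 1))) 1 := by
    intro t ht
    rw [mem_sphere_zero_iff_norm, hz]
    simp only [norm_smul, norm_inv, norm_norm]
    exact inv_mul_cancel₀ (norm_ne_zero_iff.2 (hvne t ht))
  have hzp : ∀ t (ht : t ∈ Icc (0 : ℝ) 1),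
      mk n ⟨z t, hzs t ht⟩ ∈ puncturedRealProjectiveSpace n := by
    intro t ht
    rw [mem_puncturedRealProjectiveSpace_iff_height, height_mk]
    show |z t 0| < 1 / 2
    simp only [hz, PiLp.smul_apply, smul_eq_mul]
    exact hheight t ht
  set γ : Icc (0 : ℝ) 1 → puncturedRealProjectiveSpace n :=
    fun t => ⟨mk n ⟨z t, hzs t t.2⟩, hzp t t.2⟩ with hγ
  have hγc : Continuous γ := by
    have hvc : Continuous v := by
      simp only [hv]
      exact continuous_const.sub ((continuous_id.mul continuous_const).smul continuous_const)
    have hzc : ContinuousOn z (Icc 0 1) := by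
      simp only [hz]
      exact (ContinuousOn.inv₀ (hvc.norm.continuousOn) fun t ht => norm_ne_zero_iff.2 (hvne t ht)).smul
        hvc.continuousOn
    have h1 : Continuous fun t : Icc (0 : ℝ) 1 => z t :=
      hzc.comp_continuous continuous_subtype_val fun t => t.2
    have h2 : Continuous fun t : Icc (0 : ℝ) 1 =>
        (⟨z t, hzs t t.2⟩ : Metric.sphere (0 : EuclideanSpace ℝ (Fin (n + 1))) 1) :=
      h1.subtype_mk _
    exact ((contMDiff_mk n).continuous.comp h2).subtype_mk _
  refine ⟨range γ, isPreconnected_range hγc, ?_, ⟨γ ⟨1, zero_le_one, le_rfl⟩, mem_range_self _, ?_⟩⟩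
  · refine ⟨⟨0, le_rfl, zero_le_one⟩, Subtype.ext ?_⟩
    show mk n ⟨z 0, _⟩ = (p : RealProjectiveSpace n)
    rw [← hy]
    congr 1
    apply Subtype.ext
    show z 0 = y
    have : v 0 = y := by simp [hv]
    simp only [hz, this, hy1, inv_one, one_smul]
  · show height (mk n ⟨z 1, _⟩) = 0
    rw [height_mk]
    show |z 1 0| = 0
    simp only [hz, PiLp.smul_apply, smul_eq_mul, hv0, sub_self, zero_mul, mul_zero, abs_zero]

/-- **A continuous map of the punctured projective space into `M` which sends the low zone
`{height < 1/4}` into a clopen set `X` sends everything into `X`.** [folklore] -/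
theorem forall_mem_of_lowZone_subset {M : Type*} [TopologicalSpace M]
    {ι : puncturedRealProjectiveSpace n → M} (hι : Continuous ι) {X : Set M} (hX : IsClopen X)
    (hlow : ∀ p : puncturedRealProjectiveSpace n, height (p : RealProjectiveSpace n) < 1 / 4 → ι p ∈ X) :
    ∀ p, ι p ∈ X := by
  intro p
  obtain ⟨s, hs, hps, q, hqs, hq⟩ := exists_isPreconnected_joining_lowZone p
  have hsub : ι '' s ⊆ X :=
    (hs.image ι hι.continuousOn).subset_isClopen hX ⟨ι q, mem_image_of_mem ι hqs, hlow q (by rw [hq]; norm_num)⟩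
  exact hsub (mem_image_of_mem ι hps)

/-- The low zone `{height < 1/4}` lies in the complement of the image of the polar cap of height
`1/4` (the set whose image is a projective cap piece). [folklore] -/
theorem not_mem_image_polarCapOf_of_height_lt {p : RealProjectiveSpace n} (hp : height p < 1 / 4) :
    p ∉ mk n '' polarCapOf n (1 / 4) := by
  rintro ⟨y, hy, rfl⟩
  rw [height_mk] at hp
  change (1 / 4 : ℝ) ≤ (y : EuclideanSpace ℝ (Fin (n + 1))) 0 at hy
  exact (abs_lt.1 hp).2.not_ge hy

end Zone


/-! ### Transporting pieces into a clopen open submanifold -/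

section TransportVal

variable {M : Type} [TopologicalSpace M] [ChartedSpace (EuclideanSpace ℝ (Fin 4)) M]
  [IsManifold (𝓡 4) ∞ M] (X : Opens M)

omit [ChartedSpace (EuclideanSpace ℝ (Fin 4)) M] [IsManifold (𝓡 4) ∞ M] in
/-- A connected range meeting the clopen set `X` lies in `X`. [folklore] -/
theorem range_subset_of_isClopen {α : Type*} [TopologicalSpace α] [PreconnectedSpace α]
    {g : α → M} (hg : Continuous g) (hX : IsClopen (X : Set M)) {a : α} (ha : g a ∈ (X : Set M)) :
    ∀ q, g q ∈ (X : Set M) := fun q =>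
  (isPreconnected_range hg).subset_isClopen hX ⟨g a, mem_range_self a, ha⟩ (mem_range_self q)

/-- **A neck piece inside a clopen open submanifold `X` is a neck piece of `X`** (relative to
`N ∩ X`): its collar has connected range meeting `C ⊆ X`, hence inside `X`, and the
corestriction of a smooth embedding to an open submanifold is a smooth embedding
(`Manifold.IsSmoothEmbedding.codRestrict_opens`). [folklore] -/
theorem IsNeckPiece.transportVal {N C : Set M} (h : IsNeckPiece N C) (hX : IsClopen (X : Set M))
    (hCX : C ⊆ (X : Set M)) (hCne : C.Nonempty) :
    IsNeckPiece (Subtype.val ⁻¹' N : Set X) (Subtype.val ⁻¹' C : Set X) := by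
  obtain ⟨ι, hι, ho, hιC, hιN⟩ := h
  obtain ⟨x₀, hx₀⟩ := hCne
  obtain ⟨q₀, hq₀, rfl⟩ := (hιC.symm ▸ hx₀ : x₀ ∈ ι '' (univ ×ˢ Ioo 0 1))
  haveI : PreconnectedSpace (Metric.sphere (0 : EuclideanSpace ℝ (Fin 4)) 1 × ℝ) := by
    have h1 : 1 < Module.rank ℝ (EuclideanSpace ℝ (Fin 4)) := by
      rw [← Module.finrank_eq_rank, finrank_euclideanSpace_fin]; norm_num
    haveI := isPreconnected_iff_preconnectedSpace.1
      (isConnected_sphere h1 (0 : EuclideanSpace ℝ (Fin 4)) zero_le_one).isPreconnected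
    infer_instance
  have hside : ∀ q, ι q ∈ (X : Set M) :=
    range_subset_of_isClopen X hι.contMDiff.continuous hX (hCX (hιC ▸ mem_image_of_mem ι hq₀))
  refine ⟨fun q => (⟨ι q, hside q⟩ : X), hι.codRestrict_opens X hside, ?_, ?_, ?_⟩
  · have : range (fun q => (⟨ι q, hside q⟩ : X)) = Subtype.val ⁻¹' range ι := by
      ext x; constructor
      · rintro ⟨q, rfl⟩; exact ⟨q, rfl⟩
      · rintro ⟨q, hq⟩; exact ⟨q, Subtype.ext hq⟩
    rw [this]
    exact ho.preimage continuous_subtype_val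
  · ext x; constructor
    · rintro ⟨q, hq, rfl⟩
      exact (hιC ▸ mem_image_of_mem ι hq : ι q ∈ C)
    · intro hx
      obtain ⟨q, hq, hqx⟩ := (hιC.symm ▸ hx : (x : M) ∈ ι '' (univ ×ˢ Ioo 0 1))
      exact ⟨q, hq, Subtype.ext hqx⟩
  · rintro _ ⟨q, hq, rfl⟩
    exact (hιN (mem_image_of_mem ι hq) : ι q ∈ N)

/-- **A ball piece inside a clopen open submanifold `X` is a ball piece of `X`.** [folklore] -/
theorem IsBallPiece.transportVal {N C : Set M} (h : IsBallPiece N C) (hX : IsClopen (X : Set M))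
    (hCX : C ⊆ (X : Set M)) (hCne : C.Nonempty) :
    IsBallPiece (Subtype.val ⁻¹' N : Set X) (Subtype.val ⁻¹' C : Set X) := by
  obtain ⟨ι, hι, ho, hιC, hιN⟩ := h
  obtain ⟨x₀, hx₀⟩ := hCne
  obtain ⟨q₀, hq₀, rfl⟩ := (hιC.symm ▸ hx₀ : x₀ ∈ ι '' ball 0 1)
  have hside : ∀ q, ι q ∈ (X : Set M) :=
    range_subset_of_isClopen X hι.contMDiff.continuous hX (hCX (hιC ▸ mem_image_of_mem ι hq₀))
  refine ⟨fun q => (⟨ι q, hside q⟩ : X), hι.codRestrict_opens X hside, ?_, ?_, ?_⟩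
  · have : range (fun q => (⟨ι q, hside q⟩ : X)) = Subtype.val ⁻¹' range ι := by
      ext x; constructor
      · rintro ⟨q, rfl⟩; exact ⟨q, rfl⟩
      · rintro ⟨q, hq⟩; exact ⟨q, Subtype.ext hq⟩
    rw [this]
    exact ho.preimage continuous_subtype_val
  · ext x; constructor
    · rintro ⟨q, hq, rfl⟩
      exact (hιC ▸ mem_image_of_mem ι hq : ι q ∈ C)
    · intro hx
      obtain ⟨q, hq, hqx⟩ := (hιC.symm ▸ hx : (x : M) ∈ ι '' ball 0 1)
      exact ⟨q, hq, Subtype.ext hqx⟩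
  · rintro _ ⟨q, hq, rfl⟩
    exact (hιN (mem_image_of_mem ι hq) : ι q ∈ N)

omit [IsManifold (𝓡 4) ∞ M] in
/-- **A projective cap piece inside a clopen open submanifold `X` makes `X` non-simply-connected**:
the collar `ι : ℝℙ⁴ ∖ 𝔹̄⁴ ↪ M` maps the low zone into `C ⊆ X`, hence everything into `X`
(`forall_mem_of_lowZone_subset`), and corestricts to an open embedding into `X`
(`not_simplyConnectedSpace_of_isOpenEmbedding_puncturedRealProjectiveSpace`).
[cite: ChenZhu2006, Thm. 1.1 (iii) (p. 3) and §4, p. 24] -/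
theorem IsProjectiveCapPiece.not_simplyConnectedSpace_opens [T2Space M] {N C : Set M}
    (h : IsProjectiveCapPiece N C) (hX : IsClopen (X : Set M)) (hCX : C ⊆ (X : Set M)) :
    ¬ SimplyConnectedSpace X := by
  obtain ⟨ι, hι, ho, hιC, -⟩ := h
  have hlow : ∀ p : puncturedRealProjectiveSpace 4,
      height (p : RealProjectiveSpace 4) < 1 / 4 → ι p ∈ (X : Set M) := fun p hp =>
    hCX (hιC ▸ mem_image_of_mem ι (not_mem_image_polarCapOf_of_height_lt hp))
  have hside : ∀ p, ι p ∈ (X : Set M) :=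
    forall_mem_of_lowZone_subset hι.contMDiff.continuous hX hlow
  have hemb : Topology.IsOpenEmbedding (fun p => (⟨ι p, hside p⟩ : X)) := by
    refine ⟨hι.isEmbedding.codRestrict (X : Set M) hside, ?_⟩
    have : range (fun p => (⟨ι p, hside p⟩ : X)) = Subtype.val ⁻¹' range ι := by
      ext x; constructor
      · rintro ⟨q, rfl⟩; exact ⟨q, rfl⟩
      · rintro ⟨q, hq⟩; exact ⟨q, Subtype.ext hq⟩
    rw [this]
    exact ho.preimage continuous_subtype_val
  exact not_simplyConnectedSpace_of_isOpenEmbedding_puncturedRealProjectiveSpace (by norm_num) hemb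

end TransportVal

/-! ### Restricting the data to a component -/

section Restrict

variable {M : Type} [TopologicalSpace M] [T2Space M] [ChartedSpace (EuclideanSpace ℝ (Fin 4)) M]
  [IsManifold (𝓡 4) ∞ M]
  {M' : Type} [TopologicalSpace M'] [T2Space M'] [ChartedSpace (EuclideanSpace ℝ (Fin 4)) M']

/-- **Restricting a surgery step to a closed connected open submanifold `X`** (a connected
component of `M`). In the unbundled setting of `SurgicalRicciFlowBallAbsorption.lean`, with the
pieces of `M ∖ N` necks, balls, projective caps or discarded closed pieces (Chen–Zhu 2006,
Thm. 1.1 (iii), collared reading of `SurgicalRicciFlow.lean`): either `X` is a discarded piece,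
or a projective cap piece lies in `X` (so `X` is not simply connected), or `X` carries data
`(N ∩ X, U ∩ X, Φ (U ∩ X), Φ|_X, Ψ)` of the same kind whose pieces — the pieces of `M ∖ N` meeting
`X` — are necks and balls, the boundary spheres of the `M'`-pieces being inside `Φ (U ∩ X)` or
disjoint from it (they are connected and lie in `Φ N = Φ (N ∩ X) ⊔ Φ (N ∖ X)`).
[cite: ChenZhu2006, Thm. 1.1 (i)–(iii) (p. 3)] -/
theorem exists_restrict_component
    {N : Set M} {N' : Set M'} {U : Set M} {U' : Set M'} {Φ : M → M'} {Ψ : M' → M}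
    (hN : IsClosed N) (hN' : IsClosed N') (hU : IsOpen U) (hNU : N ⊆ U) (hU' : IsOpen U')
    (hΦc : ContMDiffOn (𝓡 4) (𝓡 4) ∞ Φ U) (hΨc : ContMDiffOn (𝓡 4) (𝓡 4) ∞ Ψ U')
    (hΦ : MapsTo Φ U U') (hΨ : MapsTo Ψ U' U)
    (hleft : ∀ x ∈ U, Ψ (Φ x) = x) (hright : ∀ y ∈ U', Φ (Ψ y) = y) (hΦN : Φ '' N = N' ∩ U')
    (hfin : (componentsOf Nᶜ).Finite)
    (hpieces : ∀ C ∈ componentsOf Nᶜ, IsNeckPiece N C ∨ IsBallPiece N C ∨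
      IsProjectiveCapPiece N C ∨ ∃ C' : Opens M, (C' : Set M) = C ∧ IsDiscardedPiece C')
    (hM : ∀ C' ∈ componentsOf N'ᶜ, IsBallPiece N' C')
    (hfr : ∀ C' ∈ componentsOf N'ᶜ, frontier C' ⊆ U' ∨ Disjoint (frontier C') U')
    (X : Opens M) [Nonempty X] (hXc : IsClosed (X : Set M)) (hXp : IsPreconnected (X : Set M)) :
    IsDiscardedPiece X ∨ ¬ SimplyConnectedSpace X ∨
    ∃ (N₁ U₁ : Set X) (U₁' : Set M') (Φ₁ : X → M') (Ψ₁ : M' → X),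
      IsClosed N₁ ∧ IsOpen U₁ ∧ N₁ ⊆ U₁ ∧ IsOpen U₁' ∧
      ContMDiffOn (𝓡 4) (𝓡 4) ∞ Φ₁ U₁ ∧ ContMDiffOn (𝓡 4) (𝓡 4) ∞ Ψ₁ U₁' ∧
      MapsTo Φ₁ U₁ U₁' ∧ MapsTo Ψ₁ U₁' U₁ ∧
      (∀ x ∈ U₁, Ψ₁ (Φ₁ x) = x) ∧ (∀ y ∈ U₁', Φ₁ (Ψ₁ y) = y) ∧ Φ₁ '' N₁ = N' ∩ U₁' ∧
      (componentsOf N₁ᶜ).Finite ∧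
      (∀ C₁ ∈ componentsOf N₁ᶜ, IsNeckPiece N₁ C₁ ∨ IsBallPiece N₁ C₁) ∧
      ∀ C' ∈ componentsOf N'ᶜ, frontier C' ⊆ U₁' ∨ Disjoint (frontier C') U₁' := by
  classical
  haveI : LocallyConnectedSpace M :=
    ChartedSpace.locallyConnectedSpace (EuclideanSpace ℝ (Fin 4)) M
  haveI : LocallyConnectedSpace M' :=
    ChartedSpace.locallyConnectedSpace (EuclideanSpace ℝ (Fin 4)) M'
  have hXclopen : IsClopen (X : Set M) := ⟨hXc, X.2⟩
  have hCsub : ∀ C ∈ componentsOf Nᶜ, (C ∩ (X : Set M)).Nonempty → C ⊆ (X : Set M) :=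
    fun C hC hne => (isPreconnected_of_mem_componentsOf hC).subset_isClopen hXclopen hne
  -- Case 1: a discarded piece meets `X`
  by_cases hdisc : ∃ C ∈ componentsOf Nᶜ, (C ∩ (X : Set M)).Nonempty ∧
      ∃ C' : Opens M, (C' : Set M) = C ∧ IsDiscardedPiece C'
  · obtain ⟨C, hC, hne, C', hC'C, hC'd⟩ := hdisc
    left
    have h1 : C ⊆ (X : Set M) := hCsub C hC hne
    have h2 : (X : Set M) ⊆ C := by
      obtain ⟨x, hxC, hxX⟩ := hne
      refine hXp.subset_isClopen ⟨?_, ?_⟩ ⟨x, hxX, hxC⟩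
      · rw [← hC'C]; exact hC'd.1
      · rw [← hC'C]; exact C'.2
    have : C' = X := Opens.ext (hC'C.trans (Subset.antisymm h1 h2))
    exact this ▸ hC'd
  -- Case 2: a projective cap piece meets `X`
  by_cases hcap : ∃ C ∈ componentsOf Nᶜ, (C ∩ (X : Set M)).Nonempty ∧ IsProjectiveCapPiece N C
  · obtain ⟨C, hC, hne, hcapC⟩ := hcap
    exact Or.inr (Or.inl (hcapC.not_simplyConnectedSpace_opens X hXclopen (hCsub C hC hne)))
  -- Case 3: all pieces meeting `X` are necks or balls
  push Not at hdisc hcap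
  have hpieces' : ∀ C ∈ componentsOf Nᶜ, (C ∩ (X : Set M)).Nonempty →
      IsNeckPiece N C ∨ IsBallPiece N C := by
    intro C hC hne
    rcases hpieces C hC with h | h | h | ⟨C', hC'C, hC'd⟩
    · exact Or.inl h
    · exact Or.inr h
    · exact absurd h (hcap C hC hne)
    · exact absurd hC'd (hdisc C hC hne C' hC'C)
  right; right
  -- the new sets
  set T : Set M → Set X := fun C => Subtype.val ⁻¹' C with hTdef
  set N₁ : Set X := T N with hN₁def
  set U₁ : Set X := T U with hU₁def
  set U₁' : Set M' := Φ '' (U ∩ (X : Set M)) with hU₁'def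
  set F : Set (Set X) := T '' {C ∈ componentsOf Nᶜ | (C ∩ (X : Set M)).Nonempty} with hFdef
  have hvalopen : IsOpenMap (Subtype.val : X → M) := X.2.isOpenMap_subtype_val
  -- the components of `N₁ᶜ`
  have hcover : ⋃₀ F = N₁ᶜ := by
    apply Subset.antisymm
    · rintro x ⟨_, ⟨C, ⟨hC, -⟩, rfl⟩, hx⟩
      exact fun hxN => (disjoint_of_mem_componentsOf_compl hC).le_bot ⟨hx, hxN⟩
    · intro x hx
      have hxN : (x : M) ∉ N := hx
      refine ⟨T (connectedComponentIn Nᶜ (x : M)),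
        ⟨_, ⟨connectedComponentIn_mem_componentsOf hxN, ⟨x, mem_connectedComponentIn hxN, x.2⟩⟩,
          rfl⟩, ?_⟩
      exact mem_connectedComponentIn hxN
  have hcomp : componentsOf N₁ᶜ = F := by
    refine componentsOf_eq_of_partition ?_ ?_ ?_ hcover
    · rintro _ ⟨C, ⟨hC, -⟩, rfl⟩
      exact (isOpen_of_mem_componentsOf hN.isOpen_compl hC).preimage continuous_subtype_val
    · rintro _ ⟨C, ⟨hC, hne⟩, rfl⟩
      refine (isConnected_of_mem_componentsOf hC).preimage_of_isOpenMap Subtype.val_injective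
        hvalopen ?_
      rw [Subtype.range_coe]
      exact hCsub C hC hne
    · rintro _ ⟨C, ⟨hC, -⟩, rfl⟩ _ ⟨C', ⟨hC', -⟩, rfl⟩ hneq
      refine disjoint_left.2 fun x hx hx' => hneq ?_
      rw [eq_of_mem_componentsOf_of_mem hC hC' hx hx']
  have hfinF : F.Finite := (hfin.subset (sep_subset _ _)).image T
  -- the maps
  obtain ⟨x₀⟩ := (inferInstance : Nonempty X)
  set Φ₁ : X → M' := fun x => Φ (x : M) with hΦ₁def
  set g : M' → X := fun y => if h : Ψ y ∈ (X : Set M) then ⟨Ψ y, h⟩ else x₀ with hgdef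
  have hg_val : ∀ y ∈ U₁', ((g y : X) : M) = Ψ y := by
    rintro _ ⟨z, hz, rfl⟩
    have : Ψ (Φ z) ∈ (X : Set M) := by rw [hleft z hz.1]; exact hz.2
    simp only [hgdef, dif_pos this]
  have hg_eq : ∀ {z} (hz : z ∈ U ∩ (X : Set M)), g (Φ z) = ⟨z, hz.2⟩ := fun {z} hz => by
    apply Subtype.ext
    rw [hg_val (Φ z) ⟨z, hz, rfl⟩, hleft z hz.1]
  have hU₁open : IsOpen U₁ := hU.preimage continuous_subtype_val
  have hUX : IsOpen (U ∩ (X : Set M)) := hU.inter X.2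
  have hU₁'open : IsOpen U₁' :=
    isOpen_image_of_inverse hU' hΨc.continuousOn hΦ hΨ hleft hright hUX inter_subset_left
  have hU₁'U' : U₁' ⊆ U' := by rintro _ ⟨z, hz, rfl⟩; exact hΦ hz.1
  have hΦ₁c : ContMDiffOn (𝓡 4) (𝓡 4) ∞ Φ₁ U₁ :=
    hΦc.comp contMDiff_subtype_val.contMDiffOn fun x hx => hx
  have hΨ₁c : ContMDiffOn (𝓡 4) (𝓡 4) ∞ g U₁' := by
    intro y hy
    rw [← ContMDiffWithinAt.subtypeVal_comp_iff]
    exact (hΨc y (hU₁'U' hy)).mono hU₁'U' |>.congr (fun y' hy' => hg_val y' hy') (hg_val y hy)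
  have hleft₁ : ∀ x ∈ U₁, g (Φ₁ x) = x := by
    intro x hx
    show g (Φ (x : M)) = x
    rw [hg_eq ⟨hx, x.2⟩]
  have hright₁ : ∀ y ∈ U₁', Φ₁ (g y) = y := by
    rintro _ ⟨z, hz, rfl⟩
    show Φ ((g (Φ z) : X) : M) = Φ z
    rw [hg_eq hz]
  have hmaps₁ : MapsTo Φ₁ U₁ U₁' := fun x hx => ⟨x, ⟨hx, x.2⟩, rfl⟩
  have hmaps₁' : MapsTo g U₁' U₁ := by
    rintro _ ⟨z, hz, rfl⟩
    show g (Φ z) ∈ U₁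
    rw [hg_eq hz]
    exact hz.1
  have hinΦ : ∀ z ∈ U, z ∈ N → Φ z ∈ N' := fun z _ hzN => by
    have : Φ z ∈ Φ '' N := mem_image_of_mem Φ hzN
    rw [hΦN] at this
    exact this.1
  have himage : Φ₁ '' N₁ = N' ∩ U₁' := by
    apply Subset.antisymm
    · rintro _ ⟨x, hx, rfl⟩
      exact ⟨hinΦ _ (hNU hx) hx, ⟨x, ⟨hNU hx, x.2⟩, rfl⟩⟩
    · rintro y ⟨hyN', ⟨z, hz, rfl⟩⟩
      obtain ⟨z₀, hz₀, he⟩ := (hΦN.symm ▸ ⟨hyN', hΦ hz.1⟩ : Φ z ∈ Φ '' N)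
      have : z₀ = z := by rw [← hleft z₀ (hNU hz₀), he, hleft z hz.1]
      subst this
      exact ⟨⟨z₀, hz.2⟩, hz₀, rfl⟩
  -- types of the pieces
  have htypes : ∀ C₁ ∈ F, IsNeckPiece N₁ C₁ ∨ IsBallPiece N₁ C₁ := by
    rintro _ ⟨C, ⟨hC, hne⟩, rfl⟩
    have hCX := hCsub C hC hne
    have hCne : C.Nonempty := nonempty_of_mem_componentsOf hC
    rcases hpieces' C hC hne with h | h
    · exact Or.inl (h.transportVal X hXclopen hCX hCne)
    · exact Or.inr (h.transportVal X hXclopen hCX hCne)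
  -- boundary spheres of the `M'`-pieces
  have hfr₁ : ∀ C' ∈ componentsOf N'ᶜ, frontier C' ⊆ U₁' ∨ Disjoint (frontier C') U₁' := by
    intro C' hC'
    rcases hfr C' hC' with h | h
    · obtain ⟨ι', hι', -, hι'C, -⟩ := hM C' hC'
      have hC'o : IsOpen C' := isOpen_of_mem_componentsOf hN'.isOpen_compl hC'
      have hpre : IsPreconnected (frontier C') := by
        rw [hC'o.frontier_eq, IsBallPiece.closure_diff_eq_of_witness hι'.contMDiff.continuous
          hι'.isEmbedding.injective hι'C]
        have h1 : 1 < Module.rank ℝ (EuclideanSpace ℝ (Fin 4)) := by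
          rw [← Module.finrank_eq_rank, finrank_euclideanSpace_fin]; norm_num
        exact (isConnected_sphere h1 (0 : EuclideanSpace ℝ (Fin 4)) zero_le_one).isPreconnected.image
          _ hι'.contMDiff.continuous.continuousOn
      have hfaro : IsOpen (U ∩ (X : Set M)ᶜ) := hU.inter hXc.isOpen_compl
      have hO₂ : IsOpen (Φ '' (U ∩ (X : Set M)ᶜ)) :=
        isOpen_image_of_inverse hU' hΨc.continuousOn hΦ hΨ hleft hright hfaro inter_subset_left
      have hdisj : Disjoint U₁' (Φ '' (U ∩ (X : Set M)ᶜ)) := by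
        refine disjoint_left.2 ?_
        rintro _ ⟨z, hz, rfl⟩ ⟨z', hz', he⟩
        have : z' = z := by rw [← hleft z' hz'.1, he, hleft z hz.1]
        subst this
        exact hz'.2 hz.2
      have hsub : frontier C' ⊆ U₁' ∪ Φ '' (U ∩ (X : Set M)ᶜ) := by
        intro y hy
        have hyN' : y ∈ N' := by
          rw [hC'o.frontier_eq] at hy
          exact IsBallPiece.closure_diff_subset (hM C' hC')
            (disjoint_of_mem_componentsOf_compl hC') hy
        obtain ⟨z, hz, rfl⟩ := (hΦN.symm ▸ ⟨hyN', h hy⟩ : y ∈ Φ '' N)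
        by_cases hzX : z ∈ (X : Set M)
        · exact Or.inl ⟨z, ⟨hNU hz, hzX⟩, rfl⟩
        · exact Or.inr ⟨z, ⟨hNU hz, hzX⟩, rfl⟩
      rcases hpre.subset_or_subset hU₁'open hO₂ hdisj hsub with h' | h'
      · exact Or.inl h'
      · exact Or.inr (disjoint_left.2 fun y hy hy' => hdisj.le_bot ⟨hy', h' hy⟩)
    · exact Or.inr (h.mono_right hU₁'U')
  refine ⟨N₁, U₁, U₁', Φ₁, g, hN.preimage continuous_subtype_val, hU₁open, fun x hx => hNU hx,
    hU₁'open, hΦ₁c, hΨ₁c, hmaps₁, hmaps₁', hleft₁, hright₁, himage, hcomp ▸ hfinF,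
    fun C₁ hC₁ => htypes C₁ (hcomp ▸ hC₁), hfr₁⟩

end Restrict

end Literature.Geometry.Riemannian
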